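import Mathlib
import Summits.MatrixMultiplication.Statement
import Summits.MatrixMultiplication.MatrixMultiplication.Theorems.GraphEquationsCorankUnmasking
import Summits.MatrixMultiplication.MatrixMultiplication.Theorems.GraphEquationsCubicMaskedSquare

/-!
# Pivot designs: correct cubic systems of corank `≥ |P|` at EVERY graph point (`GraphEquations`, M54)

Decomp-mm node «GraphEquations» (lens 5, g42); attacked leaf `MultiplicityReduction`
(stmt-MatrixMultiplication-27806).  Target VERBATIM: `_root_.MatrixMultiplication`.  Route-neutral: the
cut `closes (hV) (hM)` is untouched.  With its sequel `GraphEquationsPivotDesignGrowth` (M55) this file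
DECIDES ask (2) of NODE-g41 (the ORDER of the corank dial `CorankBound n c` of M52) NEGATIVELY.

A PIVOT DESIGN (`PivotDesign`) is a set `P` of pivot positions, a set of slot ROWS and a serving map
`srow : P → slot rows` with the CROSS CONDITION: distinct pivots `q ≠ q'` served by the same row have
`(q'.1, q.2) ∉ P`.  Writing `f = C − AB` and `G(r)` for the group of pivots served by row `r`, its SQUARE
system of `n²` affine (= cubic, M43/M49) tests (`PivotDesign.system`) is
* `f_q`                                                       at coordinate positions (`coordTest`),
* `f_{(r,k)} − Σ_{p ∈ G(r)} a_{(p.1,k)} · f_p`                at the positions of a slot row `r` (`slotTestD`),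
* `Σ_{p ∈ G(r)} c_{(p.1,q.2)} · f_p − Σ_k b_{(k,q.2)} · f_{(r,k)}`   at a pivot `q` served by `r` (`pivotTestD`).
Theorems (no `sorry`): `pivotTestD_eval_add` — the UNMASKING IDENTITY
`T_q + Σ_k b_{(k,q.2)} σ_{(r,k)} = Σ_{p∈G(r)} f_{(p.1,q.2)}·f_p` (`= f_q²` on the zeros of the coordinate
tests, by the cross condition); `system_correct` — the zero set is EXACTLY the graph; `system_isKer` — for
every pivot `q` the degree-one field `Λ_q(A) = e_q + Σ_k a_{(q.1,k)} e_{(srow q,k)}` is a kernel direction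
of the `C`-Jacobian at EVERY base point; `kerVec_linearIndependent`, `card_piv_le_finrank` — corank `≥ |P|`
everywhere; `not_corankBound` — `¬ CorankBound n c` for every `c < |P|`.  M51a's masked square system is
the design with `|P| = 1`; designs with `|P| = n − 1` and `|P| = n^{3/2}/4` are in M55.
Sources: [BurgisserClausenShokrollahi1997, Problem 16.3, (15.1)]; [Strassen1973]; the cell's M51a/M52.
-/

-- dupNamespace: forced by the nested Summit.MatrixMultiplication.MatrixMultiplication layout (D-0017)
set_option linter.dupNamespace false

noncomputable section

namespace Summit.MatrixMultiplication.MatrixMultiplication.Theorems.GraphEquations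

open Matrix

variable {n : ℕ}

/-! ## Group vectors -/

/-- The vector `Σ_{p ∈ G} X_{(p.1, k)} · e_p`. -/
def grpVec (G : Finset (Fin n × Fin n)) (k : Fin n) (X : Vec n) : Vec n :=
  fun p => if p ∈ G then X (p.1, k) else 0

/-- The operator `X ↦ grpVec G k X`. -/
def grpOp (G : Finset (Fin n × Fin n)) (k : Fin n) : SqMat n :=
  Matrix.of fun p v => if p ∈ G ∧ v = (p.1, k) then 1 else 0

/-- `grpOp G k` sends `X` to `grpVec G k X`. -/
theorem grpOp_mulVec (G : Finset (Fin n × Fin n)) (k : Fin n) (X : Vec n) :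
    grpOp G k *ᵥ X = grpVec G k X := by
  ext p
  by_cases hp : p ∈ G
  · simp [grpOp, grpVec, mulVec, dotProduct, hp]
  · simp [grpOp, grpVec, mulVec, dotProduct, hp]

/-- Pairing with a group vector: `⟨grpVec G k X, Y⟩ = Σ_{p ∈ G} X_{(p.1,k)} Y_p`. -/
theorem grpVec_dotProduct (G : Finset (Fin n × Fin n)) (k : Fin n) (X Y : Vec n) :
    grpVec G k X ⬝ᵥ Y = ∑ p ∈ G, X (p.1, k) * Y p := by
  simp only [dotProduct, grpVec, ite_mul, zero_mul]
  exact Fintype.sum_ite_mem G _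

/-! ## Pivot designs -/

/-- A PIVOT DESIGN on the `n × n` positions: pivot positions `piv`, slot rows `slot`, and the slot row
`srow q` serving a pivot `q`, such that pivot rows are not slot rows, serving rows are slot rows, and the
CROSS CONDITION holds: for distinct pivots `q' ≠ q` with the same serving row, `(q'.1, q.2)` is not a
pivot (so a serving group is a partial permutation pattern whose crossed positions are coordinates). -/
structure PivotDesign (n : ℕ) where
  /-- `piv q`: position `q` carries a pivot test -/
  piv : Fin n × Fin n → Bool
  /-- `slot r`: row `r` is a slot row -/
  slot : Fin n → Bool
  /-- the slot row serving the pivot `q` (junk off the pivots) -/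
  srow : Fin n × Fin n → Fin n
  /-- a pivot row is not a slot row -/
  slot_fst_eq_false : ∀ q, piv q = true → slot q.1 = false
  /-- the serving row of a pivot is a slot row -/
  slot_srow : ∀ q, piv q = true → slot (srow q) = true
  /-- CROSS CONDITION inside a serving group -/
  cross : ∀ q q', piv q = true → piv q' = true → srow q' = srow q → q' ≠ q → piv (q'.1, q.2) = false

namespace PivotDesign

variable (D : PivotDesign n)

/-- The GROUP of a row `r`: the pivots served by `r`. -/
def grp (r : Fin n) : Finset (Fin n × Fin n) :=
  Finset.univ.filter fun q => D.piv q = true ∧ D.srow q = r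

/-- Membership in a group. -/
theorem mem_grp {r : Fin n} {q : Fin n × Fin n} : q ∈ D.grp r ↔ D.piv q = true ∧ D.srow q = r := by
  simp [grp]

/-- A pivot belongs to the group of its serving row. -/
theorem mem_grp_self {q : Fin n × Fin n} (hq : D.piv q = true) : q ∈ D.grp (D.srow q) :=
  D.mem_grp.mpr ⟨hq, rfl⟩

/-- A pivot's row is not a slot row. -/
theorem fst_ne_of_slot {q : Fin n × Fin n} (hq : D.piv q = true) {r : Fin n} (hr : D.slot r = true) :
    q.1 ≠ r := by
  intro h
  have h' := D.slot_fst_eq_false q hq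
  rw [h] at h'
  rw [h'] at hr
  exact Bool.false_ne_true hr

/-- A position in a slot row is not a pivot. -/
theorem piv_eq_false_of_slot {p : Fin n × Fin n} (hp : D.slot p.1 = true) : D.piv p = false := by
  rcases hb : D.piv p with _ | _
  · rfl
  · have h' := D.slot_fst_eq_false p hb
    rw [h'] at hp
    exact (Bool.false_ne_true hp).elim

/-! ## The tests of a design -/

/-- SLOT test at a position `q = (r, k)` of a slot row: `f_q − Σ_{p ∈ G(r)} a_{(p.1, k)} · f_p`
(`κ = e_q`, `L_A A = −Σ_{p∈G(r)} a_{(p.1,k)} e_p`, no `B`- or `C`-part). -/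
def slotTestD (q : Fin n × Fin n) : AffTest n :=
  ⟨Pi.single q 1, -grpOp (D.grp q.1) q.2, 0, 0⟩

/-- PIVOT test at a pivot `q` served by `r = srow q`:
`Σ_{p ∈ G(r)} c_{(p.1, q.2)} · f_p − Σ_k b_{(k, q.2)} · f_{(r, k)}` (`κ = 0`, `L_A = 0`,
`L_B B = −Σ_k b_{(k,q.2)} e_{(r,k)}`, `M C = Σ_{p∈G(r)} c_{(p.1,q.2)} e_p` — the quadratic parts). -/
def pivotTestD (q : Fin n × Fin n) : AffTest n :=
  ⟨0, 0, -slotOp (D.srow q) q.2, grpOp (D.grp (D.srow q)) q.2⟩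

/-- The test at position `q`: pivot tests at pivots, slot tests on slot rows, coordinates elsewhere. -/
def test (q : Fin n × Fin n) : AffTest n :=
  if D.piv q = true then D.pivotTestD q else if D.slot q.1 = true then D.slotTestD q else coordTest q

/-- **The design's square system**: `n²` cubic tests indexed by positions. -/
def system : AffSystem n := ⟨n * n, fun j => D.test ((flat n).symm j)⟩

/-- The test at flat index `flat n q` is the test at position `q`. -/
theorem system_test (q : Fin n × Fin n) : D.system.test (flat n q) = D.test q := by
  simp [system]

section evals

variable (A B C : Vec n)

/-- Coefficient vector of a slot test: `e_q − Σ_{p∈G(q.1)} a_{(p.1,q.2)} e_p`. -/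
theorem slotTestD_coef (q : Fin n × Fin n) :
    (D.slotTestD q).coef A B C = Pi.single q 1 - grpVec (D.grp q.1) q.2 A := by
  simp [slotTestD, AffTest.coef, Matrix.neg_mulVec, grpOp_mulVec, sub_eq_add_neg]

/-- Value of a slot test: `f_q − Σ_{p∈G(q.1)} a_{(p.1,q.2)} · f_p`. -/
theorem slotTestD_eval (q : Fin n × Fin n) :
    (D.slotTestD q).eval A B C =
      (C - prodVec A B) q - ∑ p ∈ D.grp q.1, A (p.1, q.2) * (C - prodVec A B) p := by
  rw [AffTest.eval, slotTestD_coef, sub_dotProduct, single_dotProduct, one_mul, grpVec_dotProduct]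

/-- Gradient of a slot test on the graph: `e_q − Σ_{p∈G(q.1)} a_{(p.1,q.2)} e_p`. -/
theorem slotTestD_jac (q : Fin n × Fin n) :
    (D.slotTestD q).jac A B = Pi.single q 1 - grpVec (D.grp q.1) q.2 A :=
  D.slotTestD_coef A B _ q

/-- Coefficient vector of a pivot test: `Σ_{p∈G(r)} c_{(p.1,q.2)} e_p − Σ_k b_{(k,q.2)} e_{(r,k)}`. -/
theorem pivotTestD_coef (q : Fin n × Fin n) :
    (D.pivotTestD q).coef A B C =
      grpVec (D.grp (D.srow q)) q.2 C - fun p => if p.1 = D.srow q then B (p.2, q.2) else 0 := by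
  simp only [pivotTestD, AffTest.coef, zero_mulVec, add_zero, zero_add, neg_mulVec, slotOp_mulVec,
    grpOp_mulVec]
  abel

/-- Value of a pivot test: `Σ_{p∈G(r)} c_{(p.1,q.2)} · f_p − Σ_k b_{(k,q.2)} · f_{(r,k)}`. -/
theorem pivotTestD_eval (q : Fin n × Fin n) :
    (D.pivotTestD q).eval A B C =
      ∑ p ∈ D.grp (D.srow q), C (p.1, q.2) * (C - prodVec A B) p
        - ∑ k, B (k, q.2) * (C - prodVec A B) (D.srow q, k) := by
  rw [AffTest.eval, pivotTestD_coef, sub_dotProduct, grpVec_dotProduct, rowVec_dotProduct]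

/-- Gradient of a pivot test on the graph: `Σ_{p∈G(r)} (AB)_{(p.1,q.2)} e_p − Σ_k b_{(k,q.2)} e_{(r,k)}`. -/
theorem pivotTestD_jac (q : Fin n × Fin n) :
    (D.pivotTestD q).jac A B =
      grpVec (D.grp (D.srow q)) q.2 (prodVec A B)
        - fun p => if p.1 = D.srow q then B (p.2, q.2) else 0 :=
  D.pivotTestD_coef A B _ q

/-- **Unmasking identity of a design**: `T_q + Σ_k b_{(k,q.2)} · σ_{(r,k)} = Σ_{p∈G(r)} f_{(p.1,q.2)} · f_p`
identically on `ℂ^{3n²}` (`r = srow q`). -/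
theorem pivotTestD_eval_add (q : Fin n × Fin n) :
    (D.pivotTestD q).eval A B C + ∑ k, B (k, q.2) * (D.slotTestD (D.srow q, k)).eval A B C =
      ∑ p ∈ D.grp (D.srow q), (C - prodVec A B) (p.1, q.2) * (C - prodVec A B) p := by
  have hsum : ∑ k, B (k, q.2) * (D.slotTestD (D.srow q, k)).eval A B C =
      ∑ k, B (k, q.2) * (C - prodVec A B) (D.srow q, k)
        - ∑ p ∈ D.grp (D.srow q), prodVec A B (p.1, q.2) * (C - prodVec A B) p := by
    simp only [slotTestD_eval, mul_sub, Finset.sum_sub_distrib, Finset.mul_sum]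
    congr 1
    rw [Finset.sum_comm]
    refine Finset.sum_congr rfl fun p _ => ?_
    rw [show prodVec A B (p.1, q.2) = ∑ k, A (p.1, k) * B (k, q.2) from rfl, Finset.sum_mul]
    exact Finset.sum_congr rfl fun k _ => by ring
  rw [hsum, pivotTestD_eval]
  calc
    _ = ∑ p ∈ D.grp (D.srow q), C (p.1, q.2) * (C - prodVec A B) p
          - ∑ p ∈ D.grp (D.srow q), prodVec A B (p.1, q.2) * (C - prodVec A B) p := by ring
    _ = _ := by
      rw [← Finset.sum_sub_distrib]
      exact Finset.sum_congr rfl fun p _ => by simp only [Pi.sub_apply]; ring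

end evals

/-! ## Correctness -/

/-- **Every pivot design is CORRECT**: the zero set of its system is exactly the graph. -/
theorem system_correct : D.system.Correct := by
  intro A B C h
  have hq : ∀ q : Fin n × Fin n, (D.test q).eval A B C = 0 := fun q => by
    simpa [system_test] using h (flat n q)
  -- coordinate tests
  have hcoord : ∀ q : Fin n × Fin n, D.piv q = false → D.slot q.1 = false →
      (C - prodVec A B) q = 0 := by
    intro q h1 h2
    have := hq q
    rw [test, if_neg (by simp [h1]), if_neg (by simp [h2]), coordTest_eval] at this
    exact this
  -- pivot tests: `f_q² = 0`
  have hpiv : ∀ q : Fin n × Fin n, D.piv q = true → (C - prodVec A B) q = 0 := by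
    intro q h1
    have hT := hq q
    rw [test, if_pos h1] at hT
    have hS : ∑ k, B (k, q.2) * (D.slotTestD (D.srow q, k)).eval A B C = 0 :=
      Finset.sum_eq_zero fun k _ => by
        have := hq (D.srow q, k)
        have hns : D.piv (D.srow q, k) = false := D.piv_eq_false_of_slot (D.slot_srow q h1)
        rw [test, if_neg (by simp [hns]), if_pos (D.slot_srow q h1)] at this
        rw [this, mul_zero]
    have key := D.pivotTestD_eval_add A B C q
    rw [hT, hS, zero_add, Finset.sum_eq_single q] at key
    · simp only [Prod.mk.eta] at key
      exact mul_self_eq_zero.mp key.symm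
    · intro p hp hpq
      obtain ⟨hp1, hp2⟩ := D.mem_grp.mp hp
      rw [hcoord (p.1, q.2) (D.cross q p h1 hp1 hp2 hpq) (D.slot_fst_eq_false p hp1), zero_mul]
    · intro hnot
      exact absurd (D.mem_grp_self h1) hnot
  -- slot tests
  have hslot : ∀ q : Fin n × Fin n, D.piv q = false → D.slot q.1 = true →
      (C - prodVec A B) q = 0 := by
    intro q h1 h2
    have := hq q
    rw [test, if_neg (by simp [h1]), if_pos h2, slotTestD_eval] at this
    rw [Finset.sum_eq_zero (fun p hp => by rw [hpiv p (D.mem_grp.mp hp).1, mul_zero]),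
      sub_zero] at this
    exact this
  have hzero : C - prodVec A B = 0 := by
    funext q
    rcases h1 : D.piv q with _ | _
    · rcases h2 : D.slot q.1 with _ | _
      · exact hcoord q h1 h2
      · exact hslot q h1 h2
    · exact hpiv q h1
  exact sub_eq_zero.mp hzero

/-! ## The kernel fields: one per pivot, masked everywhere -/

/-- The degree-one kernel field of the pivot `q`: `Λ_q(A) = e_q + Σ_k a_{(q.1,k)} e_{(srow q, k)}`. -/
def kerVec (A : Vec n) (q : Fin n × Fin n) : Vec n :=
  fun p => if p = q then 1 else if p.1 = D.srow q then A (q.1, p.2) else 0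

variable {A : Vec n}

/-- `Λ_q` at `q` is `1`. -/
theorem kerVec_self (A : Vec n) (q : Fin n × Fin n) : D.kerVec A q q = 1 := by
  simp [kerVec]

/-- `Λ_q` at a pivot `p` is `[p = q]`. -/
theorem kerVec_of_piv {q p : Fin n × Fin n} (hq : D.piv q = true) (hp : D.piv p = true) :
    D.kerVec A q p = if p = q then 1 else 0 := by
  by_cases hpq : p = q
  · simp [kerVec, hpq]
  · have : p.1 ≠ D.srow q := D.fst_ne_of_slot hp (D.slot_srow q hq)
    simp [kerVec, hpq, this]

/-- `Λ_q` on the serving row: `Λ_q (srow q, k) = a_{(q.1,k)}`. -/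
theorem kerVec_srow {q : Fin n × Fin n} (hq : D.piv q = true) (k : Fin n) :
    D.kerVec A q (D.srow q, k) = A (q.1, k) := by
  have hne : (D.srow q, k) ≠ q := fun h =>
    D.fst_ne_of_slot hq (D.slot_srow q hq) (congrArg Prod.fst h).symm
  simp [kerVec, hne]

/-- `Λ_q` on the serving row, positional form. -/
theorem kerVec_row {q p : Fin n × Fin n} (hp1 : p.1 = D.srow q) (hq : D.piv q = true) :
    D.kerVec A q p = A (q.1, p.2) := by
  obtain ⟨p1, p2⟩ := p
  simp only at hp1
  subst hp1
  exact D.kerVec_srow hq p2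

/-- `Λ_q = 0` off the pivot and off the serving row. -/
theorem kerVec_other {q p : Fin n × Fin n} (hpq : p ≠ q) (hp1 : p.1 ≠ D.srow q) :
    D.kerVec A q p = 0 := by
  simp [kerVec, hpq, hp1]

/-- Pairing with a group vector: `⟨grpVec G(r) k X, Λ_q⟩ = [srow q = r] · X_{(q.1,k)}`. -/
theorem grpVec_dotProduct_kerVec {q : Fin n × Fin n} (hq : D.piv q = true) (r k : Fin n) (X : Vec n) :
    grpVec (D.grp r) k X ⬝ᵥ D.kerVec A q = if D.srow q = r then X (q.1, k) else 0 := by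
  rw [grpVec_dotProduct]
  have h : ∀ p ∈ D.grp r, X (p.1, k) * D.kerVec A q p = if p = q then X (q.1, k) else 0 := by
    intro p hp
    rw [D.kerVec_of_piv hq (D.mem_grp.mp hp).1]
    by_cases hpq : p = q
    · subst hpq; simp
    · simp [hpq]
  rw [Finset.sum_congr rfl h, Finset.sum_ite_eq']
  by_cases hr : D.srow q = r
  · rw [if_pos (D.mem_grp.mpr ⟨hq, hr⟩), if_pos hr]
  · rw [if_neg (fun hm => hr (D.mem_grp.mp hm).2), if_neg hr]

/-- Pairing with a slot-row vector: `⟨Σ_k b_{(k,j)} e_{(r,k)}, Λ_q⟩ = [srow q = r] · (AB)_{(q.1,j)}`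
(`r` a slot row). -/
theorem rowVec_dotProduct_kerVec {q : Fin n × Fin n} (hq : D.piv q = true) {r : Fin n}
    (hr : D.slot r = true) (j : Fin n) (B : Vec n) :
    (fun p : Fin n × Fin n => if p.1 = r then B (p.2, j) else 0) ⬝ᵥ D.kerVec A q =
      if D.srow q = r then prodVec A B (q.1, j) else 0 := by
  rw [rowVec_dotProduct]
  by_cases h : D.srow q = r
  · subst h
    rw [if_pos rfl, show prodVec A B (q.1, j) = ∑ x, A (q.1, x) * B (x, j) from rfl]
    simp only [D.kerVec_srow hq]
    exact Finset.sum_congr rfl fun x _ => mul_comm _ _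
  · rw [if_neg h]
    refine Finset.sum_eq_zero fun x _ => ?_
    have h1 : ((r, x) : Fin n × Fin n) ≠ q := fun hx =>
      D.fst_ne_of_slot hq hr (congrArg Prod.fst hx).symm
    have h2 : ((r, x) : Fin n × Fin n).1 ≠ D.srow q := fun hx => h hx.symm
    rw [D.kerVec_other h1 h2, mul_zero]

/-- **`Λ_q(A)` is a kernel direction at EVERY base point**, for every pivot `q`. -/
theorem system_isKer {q : Fin n × Fin n} (hq : D.piv q = true) (A B : Vec n) :
    D.system.IsKer A B (D.kerVec A q) := by
  intro i
  obtain ⟨p, rfl⟩ := (flat n).surjective i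
  rw [system_test, test]
  by_cases h1 : D.piv p = true
  · -- pivot test
    rw [if_pos h1, pivotTestD_jac, sub_dotProduct, D.grpVec_dotProduct_kerVec hq,
      D.rowVec_dotProduct_kerVec hq (D.slot_srow p h1), sub_self]
  · rw [if_neg h1]
    have hpq : p ≠ q := fun h => h1 (by rw [h]; exact hq)
    by_cases h2 : D.slot p.1 = true
    · -- slot test
      rw [if_pos h2, slotTestD_jac, sub_dotProduct, single_dotProduct, one_mul,
        D.grpVec_dotProduct_kerVec hq]
      by_cases h3 : p.1 = D.srow q
      · rw [D.kerVec_row h3 hq, if_pos h3.symm, sub_self]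
      · rw [D.kerVec_other hpq h3, if_neg (fun h => h3 h.symm), sub_self]
    · -- coordinate test
      rw [if_neg h2]
      have h3 : p.1 ≠ D.srow q := fun h => h2 (by rw [h]; exact D.slot_srow q hq)
      simp [coordTest, AffTest.jac, AffTest.coef, D.kerVec_other hpq h3]

/-- **The kernel fields of the pivots are linearly independent** (at every `A`). -/
theorem kerVec_linearIndependent (A : Vec n) :
    LinearIndependent ℂ (fun q : {q // D.piv q = true} => D.kerVec A q.1) := by
  rw [Fintype.linearIndependent_iff]
  intro g hg i
  have h := congr_fun hg i.1
  simp only [Finset.sum_apply, Pi.smul_apply, smul_eq_mul, Pi.zero_apply] at h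
  rw [Finset.sum_eq_single i] at h
  · rwa [kerVec_self, mul_one] at h
  · intro j _ hji
    rw [D.kerVec_of_piv j.2 i.2, if_neg (fun h' => hji (Subtype.ext h').symm), mul_zero]
  · intro hi
    exact absurd (Finset.mem_univ i) hi

/-- **Corank `≥ |P|` at every base point.** -/
theorem card_piv_le_finrank (A B : Vec n) :
    Fintype.card {q // D.piv q = true} ≤ Module.finrank ℂ (D.system.kerSpace A B) := by
  let v : {q // D.piv q = true} → D.system.kerSpace A B :=
    fun q => ⟨D.kerVec A q.1, AffSystem.mem_kerSpace.mpr (D.system_isKer q.2 A B)⟩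
  have hv : LinearIndependent ℂ v :=
    LinearIndependent.of_comp (D.system.kerSpace A B).subtype (D.kerVec_linearIndependent A)
  exact hv.fintype_card_le_finrank

/-- **`¬ CorankBound n c` for every `c < |P|`**: a correct system whose corank is `≥ |P|` EVERYWHERE. -/
theorem not_corankBound {c : ℕ} (hc : c < Fintype.card {q // D.piv q = true}) : ¬ CorankBound n c := by
  intro h
  obtain ⟨A, B, hAB⟩ := h D.system D.system_correct
  exact absurd ((D.card_piv_le_finrank A B).trans hAB) (not_le.mpr hc)

/-- Contrapositive: `CorankBound n c` forces `|P| ≤ c` for every design. -/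
theorem card_piv_le_of_corankBound {c : ℕ} (h : CorankBound n c) :
    Fintype.card {q // D.piv q = true} ≤ c :=
  not_lt.mp fun hc => D.not_corankBound hc h

end PivotDesign

end Summit.MatrixMultiplication.MatrixMultiplication.Theorems.GraphEquations

end
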